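import Summits.CriticalPhenomena.CardyFormulaZ2.Theorems.StripClusterRates.Negative.KacFromAboveFalse
import Literature.Probability.Percolation.CrossingChains
import Literature.Probability.Percolation.LatticeWalksGM

/-!
# Band construction for two distinct spanning clusters: the event inclusion

Support file for line `two-cluster-rate-is-stationary-gap` (crux `StripClusterRates`,
stmt-CriticalPhenomena-13878), lead c5. The crux predicts `n·γ₂(n) → 2π` for the lengthwise rate
`γ₂(n)` of the event "two open left-right crossings of `[0,m]×[0,n]` lying in distinct open clusters of
the rectangle" (bond percolation on `ℤ²` at `p = 1/2`). This file is the combinatorial half of the RSW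
UPPER EDGE of the window for `lim n·γ₂(n)` (Aizenman's theorem for two spanning clusters, in
transfer-matrix order): in the rectangle of width `n = a + b + c + 3` split into three vertex-disjoint
horizontal bands — rows `0..a`, rows `a+1..a+c+2`, rows `a+c+3..n` — an open LR crossing of the bottom
band, an open LR crossing of the top band and the ABSENCE of an open top-bottom crossing of the middle
band produce two LR crossings of the big rectangle that are not joined inside it
(`band_twoClusterEvent_of_crossings`, registered sub-goal): an open path of the rectangle from the bottom
crossing to the top one, clipped between the rows `a+1` and `a+c+2` (`exists_openConnIn_clip`), would be
an open top-bottom crossing of the middle band. The probability estimate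
`p₂(m, a+b+c+3) ≥ p₁(m,a)·p₁(m,b)·p₁(m+1,c)` (independence of the three bands + duality for the middle
one) and the rate consequences `γ₂(a+b+c+3) ≤ γ₁(a)+γ₁(b)+γ₁(c)`, `limsup n·γ₂(n) ≤ 144 log 2` are
assembled in the companion files `…BandIndependence`, `…BandRateSum`, `…TwoClusterUpperWindow`.

References: M. Aizenman, Nucl. Phys. B 485 (1997) 551–582, Thm 3 (the `e^{-α n² k} … e^{-α' n² k}`
window for `n` spanning clusters, RSW-based) [Aizenman1997]; J. Cardy, J. Phys. A 31 (1998) L105,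
eq. (bb) (the predicted constants) [Cardy1998].
-/

noncomputable section

open MeasureTheory Filter Topology
open Literature.Probability.LatticeModels Literature.Probability.Percolation

namespace Summit.CriticalPhenomena.CardyFormulaZ2.Cruxes.StripClusterRates.TwoClusterRateIsStationaryGap

/-- The second coordinate is `1`-Lipschitz along the edges of `ℤ²`. [folklore] -/
theorem band_row_le_of_adj : ∀ u v : Site 2, (zdGraph 2).Adj u v → v 1 ≤ u 1 + 1 :=
  fun _ _ h => (zdGraph_adj_apply_le h 1).1

/-- The bottom band `[0,m]×[0,a]` lies in the big rectangle `[0,m]×[0,a+b+c+3]`. [folklore] -/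
theorem band_rectangle_bot_subset (m a b c : ℕ) :
    (rectangle m a : Set (Site 2)) ⊆ (rectangle m (a + b + c + 3) : Set (Site 2)) := by
  intro z hz
  simp only [Finset.mem_coe, mem_rectangle_iff] at hz ⊢
  push_cast
  omega

/-- The top band `(0, a+c+3) + [0,m]×[0,b]` lies in the big rectangle `[0,m]×[0,a+b+c+3]`. [folklore] -/
theorem band_rectangle_top_subset (m a b c : ℕ) :
    (· + pt 0 ((a : ℤ) + c + 3)) '' (rectangle m b : Set (Site 2)) ⊆
      (rectangle m (a + b + c + 3) : Set (Site 2)) := by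
  rintro z ⟨w, hw, rfl⟩
  simp only [Finset.mem_coe, mem_rectangle_iff] at hw ⊢
  simp only [Pi.add_apply, Matrix.cons_val_zero, Matrix.cons_val_one, Matrix.cons_val_fin_one]
  push_cast
  omega

/-- A left-side point of the bottom band is a left-side point of the big rectangle. [folklore] -/
theorem band_leftSide_bot_subset (m a b c : ℕ) :
    (leftSide m a : Set (Site 2)) ⊆ (leftSide m (a + b + c + 3) : Set (Site 2)) := by
  intro z hz
  simp only [Finset.mem_coe, leftSide, Finset.mem_filter, mem_rectangle_iff] at hz ⊢
  push_cast
  omega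

/-- A right-side point of the bottom band is a right-side point of the big rectangle. [folklore] -/
theorem band_rightSide_bot_subset (m a b c : ℕ) :
    (rightSide m a : Set (Site 2)) ⊆ (rightSide m (a + b + c + 3) : Set (Site 2)) := by
  intro z hz
  simp only [Finset.mem_coe, rightSide, Finset.mem_filter, mem_rectangle_iff] at hz ⊢
  push_cast
  omega

/-- A left-side point of the top band is a left-side point of the big rectangle. [folklore] -/
theorem band_leftSide_top_subset (m a b c : ℕ) :
    (· + pt 0 ((a : ℤ) + c + 3)) '' (leftSide m b : Set (Site 2)) ⊆
      (leftSide m (a + b + c + 3) : Set (Site 2)) := by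
  rintro z ⟨w, hw, rfl⟩
  simp only [Finset.mem_coe, leftSide, Finset.mem_filter, mem_rectangle_iff] at hw ⊢
  simp only [Pi.add_apply, Matrix.cons_val_zero, Matrix.cons_val_one, Matrix.cons_val_fin_one]
  push_cast
  omega

/-- A right-side point of the top band is a right-side point of the big rectangle. [folklore] -/
theorem band_rightSide_top_subset (m a b c : ℕ) :
    (· + pt 0 ((a : ℤ) + c + 3)) '' (rightSide m b : Set (Site 2)) ⊆
      (rightSide m (a + b + c + 3) : Set (Site 2)) := by
  rintro z ⟨w, hw, rfl⟩
  simp only [Finset.mem_coe, rightSide, Finset.mem_filter, mem_rectangle_iff] at hw ⊢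
  simp only [Pi.add_apply, Matrix.cons_val_zero, Matrix.cons_val_one, Matrix.cons_val_fin_one]
  push_cast
  omega

/-- The slab of the big rectangle between the rows `a+1` and `a+c+2` is the middle band
`(0, a+1) + [0,m]×[0,c+1]`. [folklore] -/
theorem band_slab_subset_mid (m a b c : ℕ) :
    (rectangle m (a + b + c + 3) : Set (Site 2)) ∩ {z | (a : ℤ) + 1 ≤ z 1 ∧ z 1 ≤ (a : ℤ) + c + 2} ⊆
      (· + pt 0 ((a : ℤ) + 1)) '' (rectangle m (c + 1) : Set (Site 2)) := by
  rintro z ⟨hz, hz1, hz2⟩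
  simp only [Finset.mem_coe, mem_rectangle_iff] at hz
  refine ⟨z - pt 0 ((a : ℤ) + 1), ?_, sub_add_cancel z _⟩
  simp only [Finset.mem_coe, mem_rectangle_iff, Pi.sub_apply, Matrix.cons_val_zero, Matrix.cons_val_one,
    Matrix.cons_val_fin_one]
  push_cast
  omega

/-- A point of the big rectangle on the row `a+1` is a bottom-side point of the middle band. [folklore] -/
theorem band_mem_bottomSide_mid {m a b c : ℕ} {z : Site 2}
    (hz : z ∈ (rectangle m (a + b + c + 3) : Set (Site 2))) (hz1 : z 1 = (a : ℤ) + 1) :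
    z ∈ (· + pt 0 ((a : ℤ) + 1)) '' (bottomSide m (c + 1) : Set (Site 2)) := by
  simp only [Finset.mem_coe, mem_rectangle_iff] at hz
  refine ⟨z - pt 0 ((a : ℤ) + 1), ?_, sub_add_cancel z _⟩
  simp only [Finset.mem_coe, bottomSide, Finset.mem_filter, mem_rectangle_iff, Pi.sub_apply,
    Matrix.cons_val_zero, Matrix.cons_val_one, Matrix.cons_val_fin_one]
  push_cast
  omega

/-- A point of the big rectangle on the row `a+c+2` is a top-side point of the middle band. [folklore] -/
theorem band_mem_topSide_mid {m a b c : ℕ} {z : Site 2}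
    (hz : z ∈ (rectangle m (a + b + c + 3) : Set (Site 2))) (hz1 : z 1 = (a : ℤ) + c + 2) :
    z ∈ (· + pt 0 ((a : ℤ) + 1)) '' (topSide m (c + 1) : Set (Site 2)) := by
  simp only [Finset.mem_coe, mem_rectangle_iff] at hz
  refine ⟨z - pt 0 ((a : ℤ) + 1), ?_, sub_add_cancel z _⟩
  simp only [Finset.mem_coe, topSide, Finset.mem_filter, mem_rectangle_iff, Pi.sub_apply,
    Matrix.cons_val_zero, Matrix.cons_val_one, Matrix.cons_val_fin_one]
  push_cast
  omega

/-- **Separation by the middle band.** If the middle band `(0,a+1) + [0,m]×[0,c+1]` of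
`[0,m]×[0,a+b+c+3]` has no open top-bottom crossing, then no open path of the big rectangle joins a
point of row `≤ a` to a point of row `≥ a+c+3` (lattice configurations): clipped between the rows `a+1`
and `a+c+2`, such a path is a top-bottom crossing of the middle band. [folklore] -/
theorem band_not_openConnIn_of_no_tbCrossing {m a b c : ℕ} {ω : BondConfig (Site 2)}
    (hω : ω ⊆ (zdGraph 2).edgeSet)
    (hmid : ω ∉ openCrossing ((· + pt 0 ((a : ℤ) + 1)) '' (rectangle m (c + 1) : Set (Site 2)))
      ((· + pt 0 ((a : ℤ) + 1)) '' (bottomSide m (c + 1) : Set (Site 2)))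
      ((· + pt 0 ((a : ℤ) + 1)) '' (topSide m (c + 1) : Set (Site 2))))
    {x y : Site 2} (hx : x 1 ≤ (a : ℤ)) (hy : (a : ℤ) + c + 3 ≤ y 1) :
    ω ∉ openConnIn (rectangle m (a + b + c + 3) : Set (Site 2)) x y := by
  intro hconn
  obtain ⟨x', y', hx', hy', hclip⟩ := exists_openConnIn_clip hω (fun z : Site 2 => z 1) band_row_le_of_adj
    (a := (a : ℤ) + 1) (b := (a : ℤ) + c + 2) (by omega) (by show x 1 ≤ (a : ℤ) + 1; omega)
    (by show (a : ℤ) + c + 2 ≤ y 1; omega) hconn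
  have hclip' := openConnIn_mono (band_slab_subset_mid m a b c) x' y' hclip
  obtain ⟨hx'S, hy'S, -⟩ := hclip
  exact hmid ⟨x', band_mem_bottomSide_mid hx'S.1 hx', y', band_mem_topSide_mid hy'S.1 hy', hclip'⟩

/-- **Band construction for two distinct spanning clusters** (registered sub-goal
`band_twoClusterEvent_of_crossings` of stmt-CriticalPhenomena-13878, lead c5). In the rectangle
`[0,m]×[0,a+b+c+3]`: an open LR crossing of the bottom band `[0,m]×[0,a]`, an open LR crossing of the
top band `(0,a+c+3) + [0,m]×[0,b]`, and NO open top-bottom crossing of the middle band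
`(0,a+1) + [0,m]×[0,c+1]` (lattice configuration `ω ⊆ E(ℤ²)`) give two open LR crossings of the big
rectangle whose left endpoints are not joined by an open path of the rectangle — the crux's
two-cluster event at width `a+b+c+3`. (Aizenman 1997, proof of Thm 3, lower bound: alternating
occupied/vacant bands; here with the planar-duality input replaced by row clipping.) [cite: Aizenman1997, Thm 3] -/
theorem band_twoClusterEvent_of_crossings : ∀ (m a b c : ℕ) (ω : BondConfig (Site 2)), ω ⊆ (zdGraph 2).edgeSet → ω ∈ lrCrossing m a → ω ∈ lrCrossingAt (pt 0 ((a : ℤ) + c + 3)) m b → ω ∉ openCrossing ((· + pt 0 ((a : ℤ) + 1)) '' (rectangle m (c + 1) : Set (Site 2))) ((· + pt 0 ((a : ℤ) + 1)) '' (bottomSide m (c + 1) : Set (Site 2))) ((· + pt 0 ((a : ℤ) + 1)) '' (topSide m (c + 1) : Set (Site 2))) → ∃ x₁ ∈ (leftSide m (a + b + c + 3) : Set (Site 2)), ∃ y₁ ∈ (rightSide m (a + b + c + 3) : Set (Site 2)), ∃ x₂ ∈ (leftSide m (a + b + c + 3) : Set (Site 2)), ∃ y₂ ∈ (rightSide m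 (a + b + c + 3) : Set (Site 2)), ω ∈ openConnIn (rectangle m (a + b + c + 3) : Set (Site 2)) x₁ y₁ ∧ ω ∈ openConnIn (rectangle m (a + b + c + 3) : Set (Site 2)) x₂ y₂ ∧ ω ∉ openConnIn (rectangle m (a + b + c + 3) : Set (Site 2)) x₁ x₂ := by
  intro m a b c ω hω hbot htop hmid
  obtain ⟨x₁, hx₁, y₁, hy₁, h₁⟩ := hbot
  obtain ⟨x₂, hx₂, y₂, hy₂, h₂⟩ := htop
  have hx₁row : x₁ 1 ≤ (a : ℤ) := by
    have := (Finset.mem_filter.1 (Finset.mem_coe.1 hx₁)).1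
    rw [mem_rectangle_iff] at this
    exact this.2.2.2
  have hx₂row : (a : ℤ) + c + 3 ≤ x₂ 1 := by
    obtain ⟨w, hw, rfl⟩ := hx₂
    have := (Finset.mem_filter.1 (Finset.mem_coe.1 hw)).1
    rw [mem_rectangle_iff] at this
    simp only [Pi.add_apply, Matrix.cons_val_one, Matrix.cons_val_fin_one]
    omega
  exact ⟨x₁, band_leftSide_bot_subset m a b c hx₁, y₁, band_rightSide_bot_subset m a b c hy₁,
    x₂, band_leftSide_top_subset m a b c hx₂, y₂, band_rightSide_top_subset m a b c hy₂,
    openConnIn_mono (band_rectangle_bot_subset m a b c) x₁ y₁ h₁,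
    openConnIn_mono (band_rectangle_top_subset m a b c) x₂ y₂ h₂,
    band_not_openConnIn_of_no_tbCrossing hω hmid hx₁row hx₂row⟩

end Summit.CriticalPhenomena.CardyFormulaZ2.Cruxes.StripClusterRates.TwoClusterRateIsStationaryGap

end
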